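import Summits.QuantumFields.BalabanUV.Beta.EriceFlowEnclosureB12AsPrintedHistoryContagionShiftFlowZeroClock

/-!
# Beta / EriceFlowEnclosureB12AsPrintedHistoryContagionShiftFlowZeroWitness — ASYMPTOTIC FREEDOM IS CONTAGIOUS, part 37: THE SQUARE-ROOT DEFECT OF THE ONE-LOOP LAW IS
# ATTAINED — NO ABSOLUTE ONE-LOOP Λ-PARAMETER UNDER A MEMORY PROFILE ALONE (kernel witness for parts 32–36).  Part 33's one-loop law bounds `|1∕t(m)² − 1∕g*² − m·β₀|` by a
# constant times `√(1∕t_a² + β*m)` for every asymptotically free box solution of every fading-memory flow; parts 34–36 therefore build only RELATIVE Λ-parameters (offsets of two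
# trajectories), never the absolute `lim_m (1∕t(m)² − m·β₀)`.  THIS PART: that is forced.  The Markov functional **`B u = 1 + u 0`** on the box ]0, ¼]^ℕ has the memory
# profile `(1, ½)` (`memoryProfile_linB`), the value **β₀ = 1** at the zero history in part 32's exact sense (`valueAtZero_linB`), the floor 1 and node U2's contraction
# regime (`1·¼ < 1·(1 − ½)`), so node U2's `solution B ¼` is a box solution from ¼ (`linB_solution`) with the AF profile `16 + m ≤ 1∕h(m)²` (`linB_profile`: an AF
# reference with `t_a = ¼`, `β* = 1 = β₀` — EVERY hypothesis of parts 32–35 is met); and its one-loop defect is EXACTLY `Σ_{l<m} h(l+1)` (`linB_defect_eq`), which is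
# **at least `√m ∕ √18`** (`linB_defect_ge`: `h(l+1) ≥ (16 + 5m∕4)^{−1∕2} ≥ (18m)^{−1∕2}` for l < m) and at most part 33's `4√(16 + m)`: the defect **DIVERGES LIKE √m**
# (`linB_defect_tendsto_atTop`), so **`1∕h(m)² − m·β₀` HAS NO LIMIT** (`linB_no_absolute_lambda`) — the square-root order of part 33 is SHARP and an absolute one-loop Λ does
# not exist at this generality (headline `no_absolute_oneLoop_lambda`: all hypotheses of part 33's `abs_invSq_sub_oneLoop_le` inhabited together with a divergent defect).
# A two-loop law needs two-loop accuracy of B at the zero history (d4-p2's (E54a) `…TwoLoopLambda`, GIVEN as data there) — NOT a consequence of a memory profile.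
# (β-flow team, prover 1, unit `b2b-balaban-beta-bflow-p1`, gen 39; ROW AP-I·Uc × NODE U2 — witness)

HONEST FRAMING (page 1 of everything the β sub-cell writes): discharging `BetaPertH` makes Bałaban's UV stability UNCONDITIONAL — a
real constructive-QFT result; it is NOT the continuum limit and NOT the Clay problem.  HONEST DEPENDENCY (cell reorg 2026-08-19,
verbatim): «continuum YM on T⁴ ⇐ BetaPertH ∧ nine spine estimates (0/9 proved); BetaPertH ⇐ (D1) ∧ (D4) ∧ CAP+tail; G-an2-4 gates
asym, D1 and NE2/3/4.»  THIS MODULE DISCHARGES NOTHING: one explicit toy functional (NOT Bałaban's β, whose memory structure and two-loop accuracy at the zero history are NOT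
PRINTED for the functional, [I] p. 298); node U2's `solution ∕ solution_seqBox ∕ memFlow_solution ∕ invSq_eq_of_memFlow ∕ mul_lower_le_drive ∕ Probes.summable_weighted`,
`T4BetaStationary.summable_profile` and part 33's `abs_invSq_sub_oneLoop_le` BY NAME — nothing restated; no definition introduced (the functional is written inline).
[I] = T. Bałaban, Commun. Math. Phys. **109** (1987) 249–301 [Balaban1987RG1].

WHAT THIS FILE PROVES (0 sorry, 0 def): `memoryProfile_linB`, `valueAtZero_linB`, `one_le_linB` ∕ `linB_le`, `linB_solution`, `linB_profile`, `linB_upper`, `linB_defect_eq`,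
`linB_defect_ge`, **`linB_defect_tendsto_atTop`**, **`linB_no_absolute_lambda`**, `linB_defect_le` (part 33's bound, for comparison), HEADLINE **`no_absolute_oneLoop_lambda`**.
NOT CLAIMED: anything about Bałaban's β; `BetaPertH`; continuum; Clay.
-/

namespace Summit.QuantumFields.BalabanUV.Beta.EriceFlowEnclosureB12AsPrintedHistoryContagionShiftFlowZeroWitness

open Finset Filter Topology
open Literature.MathematicalPhysics.QuantumFieldTheory.Balaban1983to89
open Literature.MathematicalPhysics.QuantumFieldTheory.Balaban1983to89.T4CouplingMatching (sprof sprof_sq)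
open Literature.MathematicalPhysics.QuantumFieldTheory.Balaban1983to89.T4BetaStationary (SeqBox MemoryProfile summable_profile)
open Literature.MathematicalPhysics.QuantumFieldTheory.Balaban1983to89.T4BetaStationary.Probes (summable_weighted)
open Literature.MathematicalPhysics.QuantumFieldTheory.Balaban1983to89.T4BetaFlowWellPosed (MemFlow solution drive seqBox_shift solution_seqBox memFlow_solution
  invSq_eq_of_memFlow mul_lower_le_drive)
open Summit.QuantumFields.BalabanUV.Beta.EriceFlowEnclosureB12AsPrintedHistoryContagionShiftFlowZeroClock (abs_invSq_sub_oneLoop_le)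

noncomputable section

/-! ## The functional `B u = 1 + u 0` on ]0, ¼]^ℕ -/

/-- The Markov functional `u ↦ 1 + u 0` has the memory profile `(1, ½)` on every box (its dependence sits at age 0). [folklore] -/
theorem memoryProfile_linB {γ : ℝ} : MemoryProfile 1 (1 / 2) γ (fun u : ℕ → ℝ => 1 + u 0) := by
  intro u u' hu hu'
  have hs := summable_profile (θ := 1 / 2) (by norm_num) (by norm_num) hu hu'
  have h0 : (1 / 2 : ℝ) ^ 0 * |u 0 - u' 0| ≤ ∑' j, (1 / 2 : ℝ) ^ j * |u j - u' j| :=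
    hs.le_tsum 0 (fun j _ => mul_nonneg (pow_nonneg (by norm_num) j) (abs_nonneg _))
  rw [pow_zero, one_mul] at h0
  calc |1 + u 0 - (1 + u' 0)| = |u 0 - u' 0| := by ring_nf
    _ ≤ 1 * ∑' j, (1 / 2 : ℝ) ^ j * |u j - u' j| := by rw [one_mul]; exact h0

/-- Its value at the zero history is β₀ = 1, in part 32's exact sense: `|B u − 1| ≤ 1·Σ_j (½)^j u_j` on every box. [folklore] -/
theorem valueAtZero_linB {γ : ℝ} : ∀ u : ℕ → ℝ, SeqBox γ u → |(1 + u 0) - 1| ≤ 1 * ∑' j, (1 / 2 : ℝ) ^ j * u j := by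
  intro u hu
  have hs := summable_weighted (θ := 1 / 2) (by norm_num) (by norm_num) hu
  have h0 : (1 / 2 : ℝ) ^ 0 * u 0 ≤ ∑' j, (1 / 2 : ℝ) ^ j * u j :=
    hs.le_tsum 0 (fun j _ => mul_nonneg (pow_nonneg (by norm_num) j) (hu j).1.le)
  rw [pow_zero, one_mul] at h0
  rw [show (1 : ℝ) + u 0 - 1 = u 0 by ring, abs_of_pos (hu 0).1, one_mul]
  exact h0

/-- The floor: `1 ≤ B u` on the box. [folklore] -/
theorem one_le_linB {γ : ℝ} : ∀ u : ℕ → ℝ, SeqBox γ u → (1 : ℝ) ≤ 1 + u 0 := fun u hu => by linarith [(hu 0).1]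

/-- The cap: `B u ≤ 1 + γ` on the box ]0, γ]. [folklore] -/
theorem linB_le {γ : ℝ} : ∀ u : ℕ → ℝ, SeqBox γ u → 1 + u 0 ≤ 1 + γ := fun u hu => by linarith [(hu 0).2]

/-- Node U2's solution from the pin ¼ is a box solution in ]0, ¼] (node U2's §4: floor 1, contraction `1·¼ < 1·(1 − ½)`). [folklore] -/
theorem linB_solution : SeqBox (1 / 4) (solution (fun u : ℕ → ℝ => 1 + u 0) (1 / 4)) ∧
    MemFlow (fun u : ℕ → ℝ => 1 + u 0) (1 / 4) (solution (fun u : ℕ → ℝ => 1 + u 0) (1 / 4)) :=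
  ⟨solution_seqBox memoryProfile_linB (by norm_num) (by norm_num) (by norm_num) (by norm_num) le_rfl one_pos one_le_linB (by norm_num),
    memFlow_solution memoryProfile_linB (by norm_num) (by norm_num) (by norm_num) (by norm_num) le_rfl one_pos one_le_linB (by norm_num)⟩

/-- The solution is an ASYMPTOTICALLY FREE REFERENCE in the exact sense of parts 10–36: `1∕(¼)² + 1·m ≤ 1∕h(m)²` (t_a = ¼, β* = 1 = β₀). [folklore] -/
theorem linB_profile : ∀ m : ℕ, 1 / (1 / 4 : ℝ) ^ 2 + 1 * (m : ℝ) ≤ 1 / (solution (fun u : ℕ → ℝ => 1 + u 0) (1 / 4) m) ^ 2 := by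
  intro m
  obtain ⟨hs, hf⟩ := linB_solution
  rw [invSq_eq_of_memFlow hf m]
  have := mul_lower_le_drive (b := 1) one_le_linB hs m
  linarith

/-- The upper envelope: `1∕h(m)² ≤ 16 + (5∕4)·m` (the cap `B ≤ 5∕4` on ]0, ¼]). [folklore] -/
theorem linB_upper : ∀ m : ℕ, 1 / (solution (fun u : ℕ → ℝ => 1 + u 0) (1 / 4) m) ^ 2 ≤ 16 + 5 / 4 * (m : ℝ) := by
  intro m
  obtain ⟨hs, hf⟩ := linB_solution
  induction m with
  | zero => rw [hf.1]; norm_num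
  | succ m ih =>
    rw [hf.2 m]
    have := linB_le _ (seqBox_shift hs (m + 1))
    push_cast
    linarith

/-- **THE ONE-LOOP DEFECT IS THE SUM OF THE RUNNING COUPLINGS**: `1∕h(m)² − 16 − m·1 = Σ_{l<m} h(l+1)`. [folklore] -/
theorem linB_defect_eq : ∀ m : ℕ, 1 / (solution (fun u : ℕ → ℝ => 1 + u 0) (1 / 4) m) ^ 2 - 1 / (1 / 4 : ℝ) ^ 2 - (m : ℝ) * 1
    = ∑ l ∈ range m, solution (fun u : ℕ → ℝ => 1 + u 0) (1 / 4) (l + 1) := by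
  intro m
  obtain ⟨-, hf⟩ := linB_solution
  induction m with
  | zero => rw [hf.1]; simp
  | succ m ih =>
    rw [sum_range_succ, ← ih, hf.2 m]
    push_cast
    ring

/-- **THE DEFECT IS AT LEAST `√m∕√18`**: each of the m couplings `h(l+1)`, l < m, is at least `(16 + 5m∕4)^{−1∕2} ≥ (18m)^{−1∕2}` (m ≥ 1). [folklore] -/
theorem linB_defect_ge : ∀ m : ℕ, 1 ≤ m → Real.sqrt m / Real.sqrt 18
    ≤ 1 / (solution (fun u : ℕ → ℝ => 1 + u 0) (1 / 4) m) ^ 2 - 1 / (1 / 4 : ℝ) ^ 2 - (m : ℝ) * 1 := by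
  intro m hm
  obtain ⟨hs, -⟩ := linB_solution
  rw [linB_defect_eq m]
  have hm' : (1 : ℝ) ≤ m := by exact_mod_cast hm
  have h18 : (0 : ℝ) < 18 * m := by positivity
  -- each term is at least `1∕√(18 m)`
  have hterm : ∀ l ∈ range m, 1 / Real.sqrt (18 * m) ≤ solution (fun u : ℕ → ℝ => 1 + u 0) (1 / 4) (l + 1) := by
    intro l hl
    rw [mem_range] at hl
    have hq := (hs (l + 1)).1
    have hup := linB_upper (l + 1)
    have hl' : ((l + 1 : ℕ) : ℝ) ≤ m := by exact_mod_cast hl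
    have hbound : 1 / (solution (fun u : ℕ → ℝ => 1 + u 0) (1 / 4) (l + 1)) ^ 2 ≤ 18 * m := by
      push_cast at hup hl'
      linarith
    -- `1∕x² ≤ A` with x > 0 ⟹ `1∕√A ≤ x`
    have hsq : (1 / Real.sqrt (18 * m)) ^ 2 ≤ (solution (fun u : ℕ → ℝ => 1 + u 0) (1 / 4) (l + 1)) ^ 2 := by
      rw [div_pow, one_pow, Real.sq_sqrt h18.le]
      rw [div_le_iff₀ (pow_pos hq 2)] at hbound
      rw [div_le_iff₀ h18]
      linarith
    exact (pow_le_pow_iff_left₀ (by positivity) hq.le two_ne_zero).mp hsq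
  have hsum := Finset.sum_le_sum hterm
  rw [sum_const, card_range, nsmul_eq_mul] at hsum
  refine le_trans (le_of_eq ?_) hsum
  have hsm : 0 < Real.sqrt m := Real.sqrt_pos.mpr (by positivity)
  have hs18 : 0 < Real.sqrt 18 := Real.sqrt_pos.mpr (by norm_num)
  rw [Real.sqrt_mul (by norm_num : (0 : ℝ) ≤ 18), mul_one_div, div_eq_div_iff hs18.ne' (by positivity)]
  calc Real.sqrt m * (Real.sqrt 18 * Real.sqrt m) = Real.sqrt 18 * (Real.sqrt m * Real.sqrt m) := by ring
    _ = Real.sqrt 18 * m := by rw [Real.mul_self_sqrt (Nat.cast_nonneg m)]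
    _ = m * Real.sqrt 18 := by ring

/-- **THE ONE-LOOP DEFECT DIVERGES**: `1∕h(m)² − 16 − m·β₀ → +∞` (like √m). [folklore] -/
theorem linB_defect_tendsto_atTop :
    Tendsto (fun m : ℕ => 1 / (solution (fun u : ℕ → ℝ => 1 + u 0) (1 / 4) m) ^ 2 - 1 / (1 / 4 : ℝ) ^ 2 - (m : ℝ) * 1) atTop atTop := by
  have hsqrt : Tendsto (fun m : ℕ => Real.sqrt m / Real.sqrt 18) atTop atTop :=
    (Real.tendsto_sqrt_atTop.comp tendsto_natCast_atTop_atTop).atTop_div_const (Real.sqrt_pos.mpr (by norm_num))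
  refine tendsto_atTop_mono' atTop ?_ hsqrt
  filter_upwards [eventually_ge_atTop 1] with m hm
  exact linB_defect_ge m hm

/-- **NO ABSOLUTE ONE-LOOP Λ FOR THIS TRAJECTORY**: `1∕h(m)² − 16 − m·β₀` has NO finite limit. [folklore] -/
theorem linB_no_absolute_lambda :
    ¬ ∃ L : ℝ, Tendsto (fun m : ℕ => 1 / (solution (fun u : ℕ → ℝ => 1 + u 0) (1 / 4) m) ^ 2 - 1 / (1 / 4 : ℝ) ^ 2 - (m : ℝ) * 1) atTop (𝓝 L) :=
  fun ⟨L, hL⟩ => not_tendsto_nhds_of_tendsto_atTop linB_defect_tendsto_atTop L hL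

/-- For comparison, part 33's one-loop law on this trajectory: the defect is at most `(2·1∕((1 − ½)·1))·√(16 + m) = 4√(16 + m)` — the witness's √m∕√18 shows the ORDER √m of
part 33's defect is attained. [folklore] -/
theorem linB_defect_le (m : ℕ) :
    |1 / (solution (fun u : ℕ → ℝ => 1 + u 0) (1 / 4) m) ^ 2 - 1 / (1 / 4 : ℝ) ^ 2 - (m : ℝ) * 1| ≤ 2 * 1 / ((1 - 1 / 2) * 1) * sprof (1 / 4) 1 m := by
  obtain ⟨hs, hf⟩ := linB_solution
  exact abs_invSq_sub_oneLoop_le (γ := 1 / 4) (by norm_num) (by norm_num) (by norm_num) one_pos (by norm_num) valueAtZero_linB hs hf linB_profile m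

/-- **HEADLINE — THE SQUARE-ROOT DEFECT OF PART 33 IS SHARP: NO ABSOLUTE ONE-LOOP Λ-PARAMETER UNDER A MEMORY PROFILE ALONE.**  There are a functional B with a memory
profile `(C_m, θ)` on a box ]0, γ]^ℕ (C_m ≥ 0, 0 < θ < 1), a number β₀ that IS its value at the zero history (`|B u − β₀| ≤ C_m·Σ θ^j u_j`), and an asymptotically free box
solution t of `MemFlow B g* t` with a profile `1∕t_a² + β*·m ≤ 1∕t(m)²` (β* > 0) — ALL hypotheses of part 33's `abs_invSq_sub_oneLoop_le` — for which the one-loop defect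
`1∕t(m)² − 1∕g*² − m·β₀` tends to +∞: it has no limit, and no bound better than order √m holds at this generality. [folklore] -/
theorem no_absolute_oneLoop_lambda :
    ∃ (B : (ℕ → ℝ) → ℝ) (Cm θ γ β₀ gs ta bs : ℝ) (t : ℕ → ℝ),
      MemoryProfile Cm θ γ B ∧ 0 ≤ Cm ∧ 0 < θ ∧ θ < 1 ∧ 0 < bs ∧ 0 < ta ∧
      (∀ u : ℕ → ℝ, SeqBox γ u → |B u - β₀| ≤ Cm * ∑' j, θ ^ j * u j) ∧
      SeqBox γ t ∧ MemFlow B gs t ∧ (∀ m : ℕ, 1 / ta ^ 2 + bs * (m : ℝ) ≤ 1 / (t m) ^ 2) ∧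
      Tendsto (fun m : ℕ => 1 / t m ^ 2 - 1 / gs ^ 2 - (m : ℝ) * β₀) atTop atTop ∧
      ¬ ∃ L : ℝ, Tendsto (fun m : ℕ => 1 / t m ^ 2 - 1 / gs ^ 2 - (m : ℝ) * β₀) atTop (𝓝 L) := by
  obtain ⟨hs, hf⟩ := linB_solution
  exact ⟨fun u => 1 + u 0, 1, 1 / 2, 1 / 4, 1, 1 / 4, 1 / 4, 1, solution (fun u : ℕ → ℝ => 1 + u 0) (1 / 4),
    memoryProfile_linB, by norm_num, by norm_num, by norm_num, one_pos, by norm_num, valueAtZero_linB, hs, hf, linB_profile,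
    linB_defect_tendsto_atTop, linB_no_absolute_lambda⟩

end

end Summit.QuantumFields.BalabanUV.Beta.EriceFlowEnclosureB12AsPrintedHistoryContagionShiftFlowZeroWitness
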